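import Literature.IUT.HodgeArakelov.AbsTopMonoidsGenuineProducer
import Literature.IUT.HodgeArakelov.AbsTopMonoidsNonVacuityAug
import Literature.IUT.HodgeArakelov.MonoThetaCyclotomesBridgeEtTh
import Literature.FieldTheory.Galois.FixingSubgroupAbsoluteGalois
import Literature.NumberTheory.GaloisRepresentations.LocalFieldFiniteExtension
import Literature.NumberTheory.GaloisRepresentations.LocalFieldPadicProofs
import HarnessLib

/-!
# The GENUINE `AbsTopMonoids` producer of [IUTchII] Ex 1.8 at the genuine setting, over the AMBIENT closure
# `k̄ := ℚ̄_p`: `(K, ℚ̄_p)` as an MLF closure datum and `ε : G_K = Gal(ℚ̄_p/K) ⥲ (ℚ̄_p ≃ₐ[K] ℚ̄_p)` (no choice)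

S. Mochizuki, *Inter-universal Teichmüller theory II*, §1, Example 1.8 (ii)–(iv) (kurims pp. 35–39)
[claim: Mochizuki2012, status: disputed]; [AbsTopIII] Def 3.1 (i) p. 66 "`k̄` an algebraic closure of `k`"
[cite: MochizukiAbsTopIII2015, Definition 3.1 (i) p.66]; [SemiAnbd] §6 p. 69 "`K̄` an algebraic closure of `K`.
Write `G_K := Gal(K̄/K)`" [cite: MochizukiSemiAnbd2006, §6 p.69].

Companion of abc-iut-w5-d233's `AbsTopMonoidsGenuineOfSetting.lean` (p430710: `MLFClosure.ofFinite p K` with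
`k̄ := AlgebraicClosure K`, `ε` through a chosen `ℚ̄_p ≃ₐ[K] AlgebraicClosure K`).  THIS FILE uses the closure the
[SemiAnbd]/[EtTh] interfaces already fix — the ambient `ℚ̄_p = PadicAlgCl p ⊇ K` — so that `ε` involves NO choice: it is
Mathlib's `K.fixingSubgroup ≃* (ℚ̄_p ≃ₐ[K] ℚ̄_p)` made bicontinuous (abc-iut-L3's `fixingSubgroupContinuousMulEquiv K
(AlgEquiv.refl)`), i.e. literally `σ ↦ σ`.  This is the shape `({ k := k, K := PadicAlgCl p } : MLFClosure)` +
`ε`-binder consumed by abc-iut-w4-d043's `cor112_iii_model_genuineIsm_of_tower` / `…_genuineZHat_of_tower`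
(`ThetaEvaluationModelEvDiagramIsmOrbit.lean`), now SUPPLIED at `k :=` the setting's own `K`:

* `MLFClosure.ofFiniteSubfield p K` — for a finite `K ⊆ ℚ̄_p` (`IntermediateField ℚ_[p] (PadicAlgCl p)`): `(k := K`
  with its extended absolute value [abc-iut L4/S `FiniteExtension.*`, Serre *Local Fields* II §2], `k̄ := ℚ̄_p)` —
  `IsAlgClosure K ℚ̄_p` by abc-iut-L3's `isAlgClosure_of_intermediateField`;
* `TemperedCurve.mlfClosurePadic X`, `TemperedCurve.galoisEpsilonPadic X : X.GK ≃ₜ* (galois K ℚ̄_p).tmPair.Pi`, with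
  `galoisEpsilonPadic_apply : (ε σ) x = σ x`;
* `AbsTopMonoids.genuineOfDoubleUnderlinePadic (hΔ) (hq)` — L6-t13's `genuineOfModel` at
  `ThetaSetting.ofDoubleUnderline C μ hC hS hl hp2 hpl hζ hη` over `(K, ℚ̄_p, ε)`; `…_Otri` (its monoid IS `𝒪^⊳_{ℚ̄_p}` as
  the non-zero integers of `ℚ̄_p` over `𝒪_K`); `…_of_isOpenMap` ((H2) from «`Π^tp_X → G_K` open», w5-d105's
  `quotDeltaX_iso_of_isOpenMap`).

HONEST SCOPE: definitions + bookkeeping (post-freeze data, reading (ii)); (H1)/(H2) are hypotheses ((H1) at this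
setting is reduced to one [AbsTopI] Thm 2.6 (v) regime by `ThetaSettingDeltaCharacteristicGenuine.lean`, p429527); the
producer is L6-t13's (`Ism` degenerate); no curve / theta setting is asserted to exist; nothing here bears on [IUTchIII]
Cor. 3.12; no side is taken; typed ≠ proved elsewhere.
-/

noncomputable section

/-! ### `(K, ℚ̄_p)` as an MLF closure datum for a finite `K ⊆ ℚ̄_p` -/

namespace Literature.AnabelianGeometry.AbsoluteAnabelian

open Literature.NumberTheory.GaloisRepresentations

/-- **`(k, k̄) := (K, ℚ̄_p)` for a finite `K ⊆ ℚ̄_p`** ([AbsTopIII] Def 3.1 (i); [SemiAnbd] §6 "`K̄` an algebraic closure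
of `K`" — here THE ambient `ℚ̄_p`): `k := K` with the extended absolute value of `ℚ_p` (Serre II §2 Prop. 3),
`k̄ := ℚ̄_p ⊇ K`, an algebraic closure of `K` (`isAlgClosure_of_intermediateField`).
[cite: MochizukiAbsTopIII2015, Definition 3.1 (i) p.66] -/
def MLFClosure.ofFiniteSubfield (p : ℕ) [Fact p.Prime] (K : IntermediateField ℚ_[p] (PadicAlgCl p))
    [FiniteDimensional ℚ_[p] K] : MLFClosure.{0} :=
  letI : IsNonarchimedeanLocalField ℚ_[p] := Padic.isNonarchimedeanLocalField_holds p
  letI := FiniteExtension.valuativeRel ℚ_[p] K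
  letI := FiniteExtension.topologicalSpace ℚ_[p] K
  haveI := FiniteExtension.isNonarchimedeanLocalField ℚ_[p] K
  haveI : CharZero K := charZero_of_injective_algebraMap (algebraMap ℚ_[p] K).injective
  haveI : IsAlgClosure K (PadicAlgCl p) := Literature.FieldTheory.Galois.isAlgClosure_of_intermediateField K
  { k := K, K := PadicAlgCl p }

/-- Its base field is `K` (definitional bookkeeping). [cite: MochizukiAbsTopIII2015, Definition 3.1 (i) p.66] -/
theorem MLFClosure.ofFiniteSubfield_k (p : ℕ) [Fact p.Prime] (K : IntermediateField ℚ_[p] (PadicAlgCl p))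
    [FiniteDimensional ℚ_[p] K] : (MLFClosure.ofFiniteSubfield p K).k = K := rfl

/-- Its algebraic closure is the ambient `ℚ̄_p` (definitional bookkeeping).
[cite: MochizukiAbsTopIII2015, Definition 3.1 (i) p.66] -/
theorem MLFClosure.ofFiniteSubfield_K (p : ℕ) [Fact p.Prime] (K : IntermediateField ℚ_[p] (PadicAlgCl p))
    [FiniteDimensional ℚ_[p] K] : (MLFClosure.ofFiniteSubfield p K).K = PadicAlgCl p := rfl

end Literature.AnabelianGeometry.AbsoluteAnabelian

/-! ### The same for a tempered curve over `K ⊆ ℚ̄_p`, with the choice-free `ε` -/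

namespace Literature.AnabelianGeometry.SemiGraphs.TemperedCurve

open Literature.AnabelianGeometry.AbsoluteAnabelian

variable {p : ℕ} [Fact p.Prime]

/-- **`(K, ℚ̄_p)` of a tempered curve** over the finite `K ⊆ ℚ̄_p` ([SemiAnbd] §6 p. 69).
[cite: MochizukiSemiAnbd2006, §6 p.69] -/
def mlfClosurePadic (X : TemperedCurve p) : MLFClosure.{0} :=
  @MLFClosure.ofFiniteSubfield p _ X.K X.finiteDimensional_K

/-- **The choice-free Galois identification `ε : G_K = K.fixingSubgroup ⥲ (ℚ̄_p ≃ₐ[K] ℚ̄_p) = Gal(ℚ̄_p/K)`**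
(`σ ↦ σ`, Mathlib's `IntermediateField.fixingSubgroupEquiv` made bicontinuous by abc-iut-L3's
`fixingSubgroupContinuousMulEquiv K (AlgEquiv.refl)`), with target THE topological group of the mono-analytic model
data of `X.mlfClosurePadic` ([AbsTopIII] Def 3.1 (ii) `ε_k = id`). [cite: MochizukiSemiAnbd2006, §6 p.69] -/
def galoisEpsilonPadic (X : TemperedCurve p) :
    X.GK ≃ₜ* (ModelMLFGaloisData.galois X.mlfClosurePadic.k X.mlfClosurePadic.K).tmPair.Pi := by
  exact (Literature.FieldTheory.Galois.fixingSubgroupContinuousMulEquiv X.K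
    (AlgEquiv.refl : PadicAlgCl p ≃ₐ[X.K] PadicAlgCl p) :)

/-- `ε σ` acts on `ℚ̄_p` as `σ` itself. [cite: MochizukiSemiAnbd2006, §6 p.69] -/
theorem galoisEpsilonPadic_apply (X : TemperedCurve p) (σ : X.GK) (x : PadicAlgCl p) :
    (show PadicAlgCl p ≃ₐ[X.K] PadicAlgCl p from X.galoisEpsilonPadic σ) x = (σ : GQp p) x := rfl

end Literature.AnabelianGeometry.SemiGraphs.TemperedCurve

/-! ### The genuine producer at the genuine setting over `(K, ℚ̄_p, ε)` -/

namespace Literature.IUT.HodgeArakelov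

open Literature.AnabelianGeometry.AbsoluteAnabelian
open Literature.AnabelianGeometry.EtaleTheta Literature.AnabelianGeometry.SemiGraphs
open scoped Literature.AnabelianGeometry.EtaleTheta

namespace AbsTopMonoids

variable {p : ℕ} [Fact p.Prime] {D : Literature.AnabelianGeometry.EtaleTheta.ThetaSetting p}
  {ED : D.EtaleThetaData} {l : ℕ} (C : ED.DoubleUnderline l) {N : ℕ+} (μ : D.CyclotomeMod l N)
  (hC : D.Compat) (hS : D.Sec2Hyps) (hl : l.Prime) (hp2 : p ≠ 2) (hpl : p ≠ l)
  (hζ : ∃ ζ : D.K, IsPrimitiveRoot ζ (4 * l)) {η : (C.thetaEnvData μ hC hS).PiYdd → MuN p N}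
  (hη : η ∈ (C.thetaEnvData μ hC hS).thetaCocycles)

/-- **The GENUINE-mod-`ε` `AbsTopMonoids` at the genuine setting over `(K, ℚ̄_p, ε = id)`**: L6-t13's `genuineOfModel`
at `S = ofDoubleUnderline C μ hC hS hl hp2 hpl hζ hη` with `X.mlfClosurePadic` / `X.galoisEpsilonPadic` for
`X = D.toTemperedCurve` — `O^⊳(G) = 𝒪^⊳_{ℚ̄_p}` (non-zero integers of `ℚ̄_p` over `𝒪_K`), `G` acting through `σ ↦ σ`.
[claim: Mochizuki2012, status: disputed] (IUTchII §1 Ex 1.8 (ii), kurims p.36) -/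
def genuineOfDoubleUnderlinePadic
    (hΔ : ∀ f : (ThetaSetting.ofDoubleUnderline C μ hC hS hl hp2 hpl hζ hη).PiX ≃ₜ*
        (ThetaSetting.ofDoubleUnderline C μ hC hS hl hp2 hpl hζ hη).PiX,
      (ThetaSetting.ofDoubleUnderline C μ hC hS hl hp2 hpl hζ hη).DeltaX.map f.toMulEquiv.toMonoidHom =
        (ThetaSetting.ofDoubleUnderline C μ hC hS hl hp2 hpl hζ hη).DeltaX)
    (hq : Nonempty (TopGroup.quot (ThetaSetting.ofDoubleUnderline C μ hC hS hl hp2 hpl hζ hη).PiX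
        (ThetaSetting.ofDoubleUnderline C μ hC hS hl hp2 hpl hζ hη).DeltaX ≃ₜ*
        (ThetaSetting.ofDoubleUnderline C μ hC hS hl hp2 hpl hζ hη).Gk)) :
    AbsTopMonoids (ThetaSetting.ofDoubleUnderline C μ hC hS hl hp2 hpl hζ hη) :=
  genuineOfModel (ThetaSetting.ofDoubleUnderline C μ hC hS hl hp2 hpl hζ hη) D.toTemperedCurve.mlfClosurePadic
    D.toTemperedCurve.galoisEpsilonPadic hΔ hq

/-- **Its monoid at every isomorph IS `𝒪^⊳_{ℚ̄_p}`** (the model `TM`-pair of `(K, ℚ̄_p)`).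
[claim: Mochizuki2012, status: disputed] (IUTchII §1 Ex 1.8 (ii), kurims p.36) -/
theorem genuineOfDoubleUnderlinePadic_Otri
    (hΔ : ∀ f : (ThetaSetting.ofDoubleUnderline C μ hC hS hl hp2 hpl hζ hη).PiX ≃ₜ*
        (ThetaSetting.ofDoubleUnderline C μ hC hS hl hp2 hpl hζ hη).PiX,
      (ThetaSetting.ofDoubleUnderline C μ hC hS hl hp2 hpl hζ hη).DeltaX.map f.toMulEquiv.toMonoidHom =
        (ThetaSetting.ofDoubleUnderline C μ hC hS hl hp2 hpl hζ hη).DeltaX)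
    (hq : Nonempty (TopGroup.quot (ThetaSetting.ofDoubleUnderline C μ hC hS hl hp2 hpl hζ hη).PiX
        (ThetaSetting.ofDoubleUnderline C μ hC hS hl hp2 hpl hζ hη).DeltaX ≃ₜ*
        (ThetaSetting.ofDoubleUnderline C μ hC hS hl hp2 hpl hζ hη).Gk))
    (G : IsoClass (ThetaSetting.ofDoubleUnderline C μ hC hS hl hp2 hpl hζ hη).Gk) :
    (genuineOfDoubleUnderlinePadic C μ hC hS hl hp2 hpl hζ hη hΔ hq).Otri G =
      (ModelMLFGaloisData.galois D.toTemperedCurve.mlfClosurePadic.k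
        D.toTemperedCurve.mlfClosurePadic.K).tmPair.M := rfl

/-- **The same with (H2) from «`Π^tp_X → G_K` open»** (abc-iut-L2-t11's `D`-indexed genuine-models-only input;
(H2) by w5-d105's `quotDeltaX_iso_of_isOpenMap` applied to the restriction to the open `Π^tp_{X̲̲}`).
[claim: Mochizuki2012, status: disputed] (IUTchII §1 Ex 1.8 (ii), kurims p.36) -/
def genuineOfDoubleUnderlinePadic_of_isOpenMap
    (hopen : IsOpenMap fun x : D.PiTemp => (⟨D.aug x, D.aug_mem_GK x⟩ : D.GK))
    (hΔ : ∀ f : (ThetaSetting.ofDoubleUnderline C μ hC hS hl hp2 hpl hζ hη).PiX ≃ₜ*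
        (ThetaSetting.ofDoubleUnderline C μ hC hS hl hp2 hpl hζ hη).PiX,
      (ThetaSetting.ofDoubleUnderline C μ hC hS hl hp2 hpl hζ hη).DeltaX.map f.toMulEquiv.toMonoidHom =
        (ThetaSetting.ofDoubleUnderline C μ hC hS hl hp2 hpl hζ hη).DeltaX) :
    AbsTopMonoids (ThetaSetting.ofDoubleUnderline C μ hC hS hl hp2 hpl hζ hη) :=
  genuineOfDoubleUnderlinePadic C μ hC hS hl hp2 hpl hζ hη hΔ
    (quotDeltaX_iso_of_isOpenMap _ (hopen.comp C.isOpen_Huu.isOpenMap_subtype_val))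

/-- Inhabitation of the interface at the genuine setting by the `(K, ℚ̄_p, ε = id)` genuine producer, under
«aug open» + (H1). [claim: Mochizuki2012, status: disputed] (IUTchII §1 Ex 1.8 (ii), kurims p.36) -/
theorem nonempty_genuinePadic_ofDoubleUnderline_of_isOpenMap
    (hopen : IsOpenMap fun x : D.PiTemp => (⟨D.aug x, D.aug_mem_GK x⟩ : D.GK))
    (hΔ : ∀ f : (ThetaSetting.ofDoubleUnderline C μ hC hS hl hp2 hpl hζ hη).PiX ≃ₜ*
        (ThetaSetting.ofDoubleUnderline C μ hC hS hl hp2 hpl hζ hη).PiX,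
      (ThetaSetting.ofDoubleUnderline C μ hC hS hl hp2 hpl hζ hη).DeltaX.map f.toMulEquiv.toMonoidHom =
        (ThetaSetting.ofDoubleUnderline C μ hC hS hl hp2 hpl hζ hη).DeltaX) :
    ∃ A : AbsTopMonoids (ThetaSetting.ofDoubleUnderline C μ hC hS hl hp2 hpl hζ hη),
      ∀ G, A.Otri G =
        (ModelMLFGaloisData.galois D.toTemperedCurve.mlfClosurePadic.k D.toTemperedCurve.mlfClosurePadic.K).tmPair.M :=
  ⟨genuineOfDoubleUnderlinePadic_of_isOpenMap C μ hC hS hl hp2 hpl hζ hη hopen hΔ, fun _ => rfl⟩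

end AbsTopMonoids

end Literature.IUT.HodgeArakelov

end
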